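import Literature.AlgebraicGeometry.Motives.HodgeNumberUpperSemicontinuous
import Literature.Analysis.InnerProduct.MinimiserStability
import HarnessLib

/-!
# Harmonic representatives under almost isometric transport (`L²`-stability)

Topic: Hodge theory in families (Voisin (2002), §9.3; Kodaira–Spencer). Theorems only, no new
facts.

Let `(M₀, g₀)` be a compact Kähler manifold (reference fibre) and `(M₁, g₁)` a compact manifold of
the same dimension with a smooth metric, `Φ : M₀ → M₁` a diffeomorphism compatible with the
orientations whose differential is almost isometric on an orthonormal frame,
`|g₁(DΦ bⱼ, DΦ bₗ) - δⱼₗ| ≤ δ`. Let `η₀` be `Δ_d`-harmonic on `M₀` and `η₁` `Δ_d`-harmonic on `M₁`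
with `[Φ^*η₁] = [η₀]` in `H^k_dR(M₀; ℂ)` (i.e. `Φ^*η₁ - η₀` exact). Then
(`exists_forall_norm_pullback_harmonic_sub_le`)

  `‖Φ^*η₁ - η₀‖_{L²(M₀)} ≤ ε ‖η₀‖_{L²(M₀)}`   as soon as `δ ≤ δ₀(ε)`.

So the harmonic representative of a FIXED class varies `L²`-continuously with the metric — the
continuity half of Kodaira–Spencer's theorem on the variation of harmonic forms, obtained here
without any elliptic estimate in the parameter: both `η₀` and `w = Φ^*η₁` lie in the fixed affine
space `η₀ + dA^{k-1}(M₀)`, `η₀` is `L²(g₀)`-orthogonal and `w` is orthogonal for the transported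
product `(a, c) ↦ (Φ_* a, Φ_* c)_{L²(M₁)}` to the exact forms (harmonic ⟂ exact, Warner 6.11), and
the two products differ by `≤ 2ε'(‖a‖² + ‖c‖²)` (the tree's
`exists_forall_norm_cl2Inner_transport_sub_le`); the elementary
`Literature.Analysis.InnerProduct.norm_sub_sq_le_of_orthogonal` concludes.

## References

* C. Voisin, *Hodge Theory and Complex Algebraic Geometry I*, CUP (2002), §5.3.1 Thm. 5.23, §9.3
  (Prop. 9.20–Thm. 9.23). [VoisinHodgeI2002]
* K. Kodaira, *Complex Manifolds and Deformation of Complex Structures* (2005), §7.2.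
  [Kodaira2005]
-/

noncomputable section

open scoped Manifold ContDiff Topology InnerProductSpace ComplexConjugate
open Bundle Module Set Filter Finset
open Literature.Geometry.Kaehler Literature.NumberTheory.Transcendental
  Literature.AlgebraicGeometry.Motives Literature.Analysis.InnerProduct

namespace Literature.AlgebraicGeometry.HodgeTheory

-- `TangentSpace 𝓘(ℝ, E) x = E` silently, as in the tree's form files.
set_option backward.isDefEq.respectTransparency false

universe u₁ u₃

/-! ### `L²` bounds for the type projectors of a Hermitian metric -/

section ProjectorBound

variable {E : Type*} [NormedAddCommGroup E] [NormedSpace ℂ E] [FiniteDimensional ℂ E] {n : ℕ}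
  [Fact (finrank ℝ E = n)] [MeasurableSpace E] [BorelSpace E]
  {M : Type*} [TopologicalSpace M] [ChartedSpace E M] [T2Space M] [CompactSpace M]
  [IsManifold 𝓘(ℝ, E) ∞ M] [IsManifold 𝓘(ℂ, E) ω M]
  [RiemannianBundle (fun x : M ↦ TangentSpace 𝓘(ℝ, E) x)]
  [IsContMDiffRiemannianBundle 𝓘(ℝ, E) ∞ E (fun x : M ↦ TangentSpace 𝓘(ℝ, E) x)]
  (o : (x : M) → Orientation ℝ (TangentSpace 𝓘(ℝ, E) x) (Fin n))
  [Fact (IsSmoothForm (riemannianVolumeForm o))] {k : ℕ}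

omit [IsManifold 𝓘(ℂ, E) ω M] in
/-- Finite sums commute with `CL2SmoothForms.toForm`. [folklore] -/
theorem CL2SmoothForms.toForm_sum {ι : Type*} (s : Finset ι) (f : ι → CL2SmoothForms o k) :
    CL2SmoothForms.toForm o (∑ i ∈ s, f i) = ∑ i ∈ s, CL2SmoothForms.toForm o (f i) :=
  map_sum (CL2SmoothForms.toFormₗ o) f s

/-- **The type projector `w ↦ w^{p,q}` does not increase the `L²` norm** for a Hermitian metric
on a compact complex manifold: `w^{p,q}` is the average of the `L²`-isometric rotated forms
`x ↦ w_x ∘ Λ^k e^{iθⱼ}` (`MForm.weightComponent_eq_sum_compContinuousLinearMap`,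
`norm_mk_compContinuousLinearMap_tangentRotate`). Voisin (2002), §5.1.1 (the decomposition into
types is orthogonal). [cite: VoisinHodgeI2002, §5.1.1] -/
theorem norm_mk_typeComponent_le
    (hJ : ∀ (x : M) (v w : TangentSpace 𝓘(ℝ, E) x), ⟪tangentJ E x v, tangentJ E x w⟫_ℝ = ⟪v, w⟫_ℝ)
    (p q : ℕ) {w : MForm 𝓘(ℝ, E) M ℂ k} (hw : IsSmoothForm w) :
    ‖CL2SmoothForms.mk o (w.typeComponent p q) (hw.typeComponent p q)‖ ≤
      ‖CL2SmoothForms.mk o w hw‖ := by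
  classical
  have hinj : ∀ a b : CL2SmoothForms o k,
      CL2SmoothForms.toForm o a = CL2SmoothForms.toForm o b → a = b := fun a b h ↦ Subtype.ext h
  by_cases hpq : p + q = k
  · have hsum : CL2SmoothForms.mk o (w.typeComponent p q) (hw.typeComponent p q) =
        ((2 * k + 1 : ℕ) : ℂ)⁻¹ • ∑ j : Fin (2 * k + 1),
        Complex.exp (-((((p : ℤ) - q : ℤ) : ℝ) * (2 * Real.pi * j / (2 * k + 1)) : ℝ) * Complex.I) •
          CL2SmoothForms.mk o (fun x ↦ (w x).compContinuousLinearMap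
            (tangentRotate E x (2 * Real.pi * j / (2 * k + 1))) : MForm 𝓘(ℝ, E) M ℂ k)
            (hw.compContinuousLinearMap_tangentRotate _) := by
      apply hinj
      rw [CL2SmoothForms.toForm_mk, CL2SmoothForms.toForm_smul, CL2SmoothForms.toForm_sum]
      simp only [CL2SmoothForms.toForm_smul, CL2SmoothForms.toForm_mk]
      rw [MForm.typeComponent, if_pos hpq, MForm.weightComponent_eq_sum_compContinuousLinearMap]
    rw [hsum, norm_smul, norm_inv, Complex.norm_natCast]
    have hN : (0 : ℝ) < (2 * k + 1 : ℕ) := by positivity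
    calc ((2 * k + 1 : ℕ) : ℝ)⁻¹ * ‖∑ j : Fin (2 * k + 1),
          Complex.exp (-((((p : ℤ) - q : ℤ) : ℝ) * (2 * Real.pi * j / (2 * k + 1)) : ℝ) * Complex.I) •
            CL2SmoothForms.mk o (fun x ↦ (w x).compContinuousLinearMap
              (tangentRotate E x (2 * Real.pi * j / (2 * k + 1))) : MForm 𝓘(ℝ, E) M ℂ k)
              (hw.compContinuousLinearMap_tangentRotate _)‖
        ≤ ((2 * k + 1 : ℕ) : ℝ)⁻¹ * ∑ j : Fin (2 * k + 1), ‖CL2SmoothForms.mk o w hw‖ := by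
          refine mul_le_mul_of_nonneg_left ((norm_sum_le _ _).trans (sum_le_sum fun j _ ↦ ?_))
            (inv_nonneg.2 hN.le)
          rw [norm_smul, ← Complex.ofReal_neg, Complex.norm_exp_ofReal_mul_I, one_mul,
            norm_mk_compContinuousLinearMap_tangentRotate o hJ _ hw]
      _ = ‖CL2SmoothForms.mk o w hw‖ := by
          rw [sum_const, card_univ, Fintype.card_fin, nsmul_eq_mul]
          field_simp
  · have h0 : CL2SmoothForms.mk o (w.typeComponent p q) (hw.typeComponent p q) = 0 :=
      hinj _ _ (by rw [CL2SmoothForms.toForm_mk, MForm.typeComponent_of_ne hpq]; rfl)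
    rw [h0, norm_zero]
    exact norm_nonneg _

/-- **`L²` bound for a partial type projector**: for `S ⊆` the antidiagonal of `k`,
`‖∑_{(p,q) ∈ S} w^{p,q}‖ ≤ (k + 1) ‖w‖`. [cite: VoisinHodgeI2002, §5.1.1] -/
theorem norm_mk_sum_typeComponent_le
    (hJ : ∀ (x : M) (v w : TangentSpace 𝓘(ℝ, E) x), ⟪tangentJ E x v, tangentJ E x w⟫_ℝ = ⟪v, w⟫_ℝ)
    (S : Finset (ℕ × ℕ)) (hS : S ⊆ antidiagonal k) {w : MForm 𝓘(ℝ, E) M ℂ k} (hw : IsSmoothForm w)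
    (hs : IsSmoothForm (∑ pq ∈ S, w.typeComponent pq.1 pq.2)) :
    ‖CL2SmoothForms.mk o (∑ pq ∈ S, w.typeComponent pq.1 pq.2) hs‖ ≤
      (k + 1) * ‖CL2SmoothForms.mk o w hw‖ := by
  classical
  have hinj : ∀ a b : CL2SmoothForms o k,
      CL2SmoothForms.toForm o a = CL2SmoothForms.toForm o b → a = b := fun a b h ↦ Subtype.ext h
  have hsum : CL2SmoothForms.mk o (∑ pq ∈ S, w.typeComponent pq.1 pq.2) hs =
      ∑ pq ∈ S, CL2SmoothForms.mk o (w.typeComponent pq.1 pq.2) (hw.typeComponent pq.1 pq.2) :=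
    hinj _ _ (by rw [CL2SmoothForms.toForm_mk, CL2SmoothForms.toForm_sum]; rfl)
  rw [hsum]
  calc ‖∑ pq ∈ S, CL2SmoothForms.mk o (w.typeComponent pq.1 pq.2) (hw.typeComponent pq.1 pq.2)‖
      ≤ ∑ pq ∈ S, ‖CL2SmoothForms.mk o w hw‖ :=
        (norm_sum_le _ _).trans (sum_le_sum fun pq _ ↦ norm_mk_typeComponent_le o hJ _ _ hw)
    _ = S.card * ‖CL2SmoothForms.mk o w hw‖ := by rw [sum_const, nsmul_eq_mul]
    _ ≤ (k + 1) * ‖CL2SmoothForms.mk o w hw‖ := by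
        refine mul_le_mul_of_nonneg_right ?_ (norm_nonneg _)
        have := Finset.card_le_card hS
        rw [Finset.Nat.card_antidiagonal] at this
        exact_mod_cast this

end ProjectorBound


variable {E₀ : Type*} [NormedAddCommGroup E₀] [NormedSpace ℂ E₀] [FiniteDimensional ℂ E₀]
  {M₀ : Type*} [TopologicalSpace M₀] [ChartedSpace E₀ M₀] [IsManifold 𝓘(ℝ, E₀) ∞ M₀]
  [T2Space M₀] [CompactSpace M₀] {n : ℕ} [Fact (finrank ℝ E₀ = n)]
  [MeasurableSpace E₀] [BorelSpace E₀]
  (g₀ : ContMDiffRiemannianMetric 𝓘(ℝ, E₀) ∞ E₀ (fun x : M₀ ↦ TangentSpace 𝓘(ℝ, E₀) x))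
  (o₀ : (x : M₀) → Orientation ℝ (TangentSpace 𝓘(ℝ, E₀) x) (Fin n))

/-- **`L²`-stability of harmonic representatives under almost isometric transport** (the
continuity half of Kodaira–Spencer; Voisin (2002), §9.3, soft form). Data: a compact Kähler
reference `(M₀, g₀, o₀)` (holomorphic atlas, `vol_{o₀}` smooth, an oriented orthonormal frame `b`),
degrees `k + m = n`, `ε > 0`. Conclusion: there is `δ₀ > 0` such that for every compact `M₁` of the
same dimension with smooth metric and smooth `vol_{o₁}`, every diffeomorphism `Φ : M₀ → M₁`
compatible with the orientations with `|g₁(DΦ bᵢ, DΦ bⱼ) - δᵢⱼ| ≤ δ ≤ δ₀`, and all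
`Δ_d`-harmonic `η₀` on `M₀`, `η₁` on `M₁` with `Φ^*η₁ - η₀` exact:
`‖Φ^*η₁ - η₀‖_{L²(M₀)} ≤ ε ‖η₀‖_{L²(M₀)}`. (No Kähler hypothesis is needed here: only
"harmonic ⟂ exact" on both sides.) [cite: VoisinHodgeI2002, §9.3.2 Prop. 9.20] -/
theorem exists_forall_norm_pullback_harmonic_sub_le
    {k m : ℕ} (h : k + m = n) {ε : ℝ} (hε : 0 < ε) :
    letI : RiemannianBundle (fun x : M₀ ↦ TangentSpace 𝓘(ℝ, E₀) x) := ⟨g₀.toRiemannianMetric⟩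
    ∀ (ho₀ : IsSmoothForm (riemannianVolumeForm o₀))
      (b : ∀ x : M₀, OrthonormalBasis (Fin n) ℝ (TangentSpace 𝓘(ℝ, E₀) x)),
      (∀ x, (b x).toBasis.orientation = o₀ x) →
      ∃ δ₀ : ℝ, 0 < δ₀ ∧ ∀ {E₁ : Type u₁} [NormedAddCommGroup E₁] [NormedSpace ℂ E₁]
        [FiniteDimensional ℂ E₁] [Fact (finrank ℝ E₁ = n)] [MeasurableSpace E₁] [BorelSpace E₁]
        {M₁ : Type u₃} [TopologicalSpace M₁] [ChartedSpace E₁ M₁] [T2Space M₁] [CompactSpace M₁]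
        [IsManifold 𝓘(ℝ, E₁) ∞ M₁] [RiemannianBundle (fun y : M₁ ↦ TangentSpace 𝓘(ℝ, E₁) y)]
        [IsContMDiffRiemannianBundle 𝓘(ℝ, E₁) ∞ E₁ (fun y : M₁ ↦ TangentSpace 𝓘(ℝ, E₁) y)]
        (o₁ : (y : M₁) → Orientation ℝ (TangentSpace 𝓘(ℝ, E₁) y) (Fin n))
        (_ho₁ : IsSmoothForm (riemannianVolumeForm o₁)) (Φ : Diffeomorph 𝓘(ℝ, E₀) 𝓘(ℝ, E₁) M₀ M₁ ∞)
        (_hΦ : ∀ x, Orientation.map (Fin n)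
          (Φ.mfderivToContinuousLinearEquiv (by simp) x).toLinearEquiv (o₀ x) = o₁ (Φ x))
        {δ : ℝ} (_hδ0 : 0 ≤ δ) (_hδ : δ ≤ δ₀)
        (_hT : ∀ x i j, |⟪mfderiv 𝓘(ℝ, E₀) 𝓘(ℝ, E₁) Φ x (b x i),
          mfderiv 𝓘(ℝ, E₀) 𝓘(ℝ, E₁) Φ x (b x j)⟫_ℝ - (if i = j then 1 else 0)| ≤ δ)
        {η₀ : MForm 𝓘(ℝ, E₀) M₀ ℂ k} (hη₀ : IsCHarmonicForm o₀ h η₀)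
        {η₁ : MForm 𝓘(ℝ, E₁) M₁ ℂ k} (hη₁ : IsCHarmonicForm o₁ h η₁)
        (_hex : η₁.pullback 𝓘(ℝ, E₀) Φ - η₀ ∈ cexactSmoothForms E₀ M₀ k),
        haveI : Fact (IsSmoothForm (riemannianVolumeForm o₀)) := ⟨ho₀⟩
        ‖CL2SmoothForms.mk o₀ (η₁.pullback 𝓘(ℝ, E₀) Φ) (isSmoothForm_pullback Φ.contMDiff hη₁.1) -
            CL2SmoothForms.mk o₀ η₀ hη₀.1‖ ≤ ε * ‖CL2SmoothForms.mk o₀ η₀ hη₀.1‖ := by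
  letI i₀ : RiemannianBundle (fun x : M₀ ↦ TangentSpace 𝓘(ℝ, E₀) x) := ⟨g₀.toRiemannianMetric⟩
  haveI : IsContMDiffRiemannianBundle 𝓘(ℝ, E₀) ∞ E₀ (fun x : M₀ ↦ TangentSpace 𝓘(ℝ, E₀) x) :=
    ⟨g₀.inner, g₀.contMDiff, fun _ _ _ ↦ rfl⟩
  intro ho₀ b hb
  haveI : Fact (IsSmoothForm (riemannianVolumeForm o₀)) := ⟨ho₀⟩
  -- the quantitative transport lemma at accuracy `ε' = min (1/12) (ε²/16)`
  set ε' : ℝ := min (1 / 12) (ε ^ 2 / 16) with hε'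
  have hε'pos : 0 < ε' := lt_min (by norm_num) (by positivity)
  have hε'₁ : ε' ≤ 1 / 12 := min_le_left _ _
  have hε'₂ : ε' ≤ ε ^ 2 / 16 := min_le_right _ _
  obtain ⟨δ₀, hδ₀, hR⟩ := exists_forall_norm_cl2Inner_transport_sub_le o₀ ho₀ b hb k hε'pos
  refine ⟨δ₀, hδ₀, ?_⟩
  intro E₁ _ _ _ _ _ _ M₁ _ _ _ _ _ _ _ o₁ ho₁ Φ hΦ δ hδ0 hδ hT η₀ hη₀ η₁ hη₁ hex
  haveI : IsContinuousRiemannianBundle E₁ (fun y : M₁ ↦ TangentSpace 𝓘(ℝ, E₁) y) :=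
    isContinuousRiemannianBundle_of_isContMDiffRiemannianBundle 𝓘(ℝ, E₁) ∞
  -- the two vectors of `A^k(M₀; ℂ)`
  have hws : IsSmoothForm (η₁.pullback 𝓘(ℝ, E₀) Φ) := isSmoothForm_pullback Φ.contMDiff hη₁.1
  set a : CL2SmoothForms o₀ k := CL2SmoothForms.mk o₀ (η₁.pullback 𝓘(ℝ, E₀) Φ) hws with ha
  set u : CL2SmoothForms o₀ k := CL2SmoothForms.mk o₀ η₀ hη₀.1 with hu
  -- the transported product and the exact forms
  let B₂ : CL2SmoothForms o₀ k → CL2SmoothForms o₀ k → ℂ := fun x y ↦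
    MForm.cl2Inner o₁ ((CL2SmoothForms.toForm o₀ x).pullback 𝓘(ℝ, E₁) Φ.symm)
      ((CL2SmoothForms.toForm o₀ y).pullback 𝓘(ℝ, E₁) Φ.symm)
  let D : Set (CL2SmoothForms o₀ k) := {v | CL2SmoothForms.toForm o₀ v ∈ cexactSmoothForms E₀ M₀ k}
  -- pull-back algebra along `Φ` and `Φ⁻¹`
  have hpb_symm : ∀ γ : MForm 𝓘(ℝ, E₁) M₁ ℂ k,
      (γ.pullback 𝓘(ℝ, E₀) Φ).pullback 𝓘(ℝ, E₁) Φ.symm = γ := by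
    intro γ
    rw [← MForm.pullback_comp (Φ.mdifferentiable (by simp)) (Φ.symm.mdifferentiable (by simp))]
    have : ((Φ : M₀ → M₁) ∘ (Φ.symm : M₁ → M₀)) = id := funext fun y ↦ Φ.apply_symm_apply y
    rw [this, MForm.pullback_id]
  have hsm : ∀ x : CL2SmoothForms o₀ k,
      IsSmoothForm ((CL2SmoothForms.toForm o₀ x).pullback 𝓘(ℝ, E₁) Φ.symm) := fun x ↦
    isSmoothForm_pullback Φ.symm.contMDiff (CL2SmoothForms.isSmoothForm_toForm o₀ x)
  -- (1) `B₂` is additive in the first variable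
  have hB₂sub : ∀ x y v, B₂ (x - y) v = B₂ x v - B₂ y v := by
    intro x y v
    change MForm.cl2Inner o₁ ((CL2SmoothForms.toForm o₀ (x - y)).pullback 𝓘(ℝ, E₁) Φ.symm) _ = _
    have hsplit : (CL2SmoothForms.toForm o₀ (x - y)).pullback 𝓘(ℝ, E₁) Φ.symm =
        (CL2SmoothForms.toForm o₀ x).pullback 𝓘(ℝ, E₁) Φ.symm +
          (-1 : ℂ) • (CL2SmoothForms.toForm o₀ y).pullback 𝓘(ℝ, E₁) Φ.symm := by
      rw [CL2SmoothForms.toForm_sub, ← MForm.cpullbackₗ_apply, map_sub, MForm.cpullbackₗ_apply,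
        MForm.cpullbackₗ_apply, neg_one_smul, sub_eq_add_neg]
    rw [hsplit, (hsm x).cl2Inner_add_left' o₁ ((hsm y).smul_complex (-1)) (hsm v) ho₁,
      (hsm y).cl2Inner_smul_left o₁ (-1) (hsm v) ho₁, map_neg, map_one, neg_one_mul,
      sub_eq_add_neg]
  -- (2) the two products are close
  have happrox : ∀ x y, ‖B₂ x y - ⟪x, y⟫_ℂ‖ ≤ 2 * ε' * (‖x‖ ^ 2 + ‖y‖ ^ 2) := by
    intro x y
    have key := hR o₁ ho₁ Φ hΦ hδ0 hδ hT (CL2SmoothForms.isSmoothForm_toForm o₀ x)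
      (CL2SmoothForms.isSmoothForm_toForm o₀ y)
    rw [CL2SmoothForms.inner_def, CL2SmoothForms.norm_sq_eq, CL2SmoothForms.norm_sq_eq]
    simpa only [mul_assoc] using key
  -- (3) `a - u ∈ D`
  have hD : a - u ∈ D := by
    change CL2SmoothForms.toForm o₀ (a - u) ∈ cexactSmoothForms E₀ M₀ k
    rw [CL2SmoothForms.toForm_sub]
    exact hex
  -- (4) `η₀ ⟂ D` for `L²(g₀)`
  have h₁ : ∀ v ∈ D, ⟪u, v⟫_ℂ = 0 := fun v hv ↦ by
    rw [CL2SmoothForms.inner_def]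
    exact cl2Inner_eq_zero_of_isCHarmonicForm_of_mem_cexactSmoothForms o₀ ho₀ h hη₀ hv
  -- (5) `Φ^*η₁ ⟂ D` for the transported product (harmonic ⟂ exact on `M₁`)
  have h₂ : ∀ v ∈ D, B₂ a v = 0 := by
    intro v hv
    change MForm.cl2Inner o₁ ((CL2SmoothForms.toForm o₀ a).pullback 𝓘(ℝ, E₁) Φ.symm) _ = 0
    have ha' : (CL2SmoothForms.toForm o₀ a).pullback 𝓘(ℝ, E₁) Φ.symm = η₁ := by
      rw [ha, CL2SmoothForms.toForm_mk, hpb_symm]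
    rw [ha']
    exact cl2Inner_eq_zero_of_isCHarmonicForm_of_mem_cexactSmoothForms o₁ ho₁ h hη₁
      (pullback_mem_cexactSmoothForms Φ.symm.contMDiff hv)
  -- the elementary stability inequality
  have hε2 : 2 * ε' < 1 / 3 := by linarith
  have key := norm_sub_sq_le_of_orthogonal B₂ D hε2 hB₂sub happrox hD h₁ h₂
  -- `‖a - u‖² ≤ (2ε'/(1 - 6ε')) ‖u‖² ≤ 4ε' ‖u‖² ≤ (ε ‖u‖)²`
  have h4 : 2 * ε' / (1 - 3 * (2 * ε')) ≤ 4 * ε' := by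
    rw [div_le_iff₀ (by linarith)]
    nlinarith
  have hsq : ‖a - u‖ ^ 2 ≤ (ε * ‖u‖) ^ 2 := by
    calc ‖a - u‖ ^ 2 ≤ 2 * ε' / (1 - 3 * (2 * ε')) * ‖u‖ ^ 2 := key
      _ ≤ 4 * ε' * ‖u‖ ^ 2 := mul_le_mul_of_nonneg_right h4 (sq_nonneg _)
      _ ≤ (ε * ‖u‖) ^ 2 := by rw [mul_pow]; nlinarith [sq_nonneg ‖u‖]
  exact (pow_le_pow_iff_left₀ (norm_nonneg _) (by positivity) two_ne_zero).1 hsq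

/-! ### Transport of the partial type projector `Π^{<p}` -/

/-- The constant of `exists_forall_norm_pullback_typeLow_sub_le`. [folklore] -/
theorem typeLowTransportConst_nonneg (n k : ℕ) :
    0 ≤ 4 * ((k : ℝ) + 2) * ((k : ℝ) + 1) *
      Real.sqrt (4 * (n : ℝ) ^ (2 * k) * ((k : ℝ) * 2 ^ (k - 1) * 2 ^ k) ^ 2) := by
  positivity

/-- **The partial type projector almost commutes with almost holomorphic, almost isometric
transport** (Voisin (2002), §9.3.2, the "types converge" step of Prop. 9.20, in operator form).
Data: a compact Hermitian reference `(M₀, g₀, o₀)` (holomorphic atlas, `vol_{o₀}` smooth, oriented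
orthonormal frame `b`), a degree `k` and `p`. Conclusion: there is `δ₀ > 0` such that for every
compact Hermitian `(M₁, g₁, o₁)` of the same dimension (holomorphic atlas, `vol_{o₁}` smooth),
every diffeomorphism `Φ : M₀ → M₁` compatible with the orientations with Gram defect `≤ δ ≤ δ₀` on
`b` and `‖J₁ DΦ - DΦ J₀‖ ≤ κ` everywhere, and every smooth `k`-form `u` on `M₁`:
`‖Φ^*(Π₁^{<p} u) - Π₀^{<p}(Φ^*u)‖_{L²(M₀)} ≤ C κ ‖Φ^*u‖_{L²(M₀)}`, where
`Π^{<p} w = ∑_{r+s=k, r<p} w^{r,s}` and `C = 4(k+2)(k+1) (4 n^{2k} (k 2^{k-1} 2^k)²)^{1/2}`.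
Proof: write `u = ∑ u^{r,s}`, `w_{rs} = Φ^*u^{r,s}`; by `re_cl2Inner_typeDefect_le`,
`‖w_{rs} - w_{rs}^{r,s}‖ ≤ √Cst κ ‖w_{rs}‖`, and
`Φ^*(Π₁ u) - Π₀(Φ^*u) = ∑_{r<p} D_{rs} - ∑_{r,s} Π₀ D_{rs}` with `D_{rs} = w_{rs} - w_{rs}^{r,s}`.
[cite: VoisinHodgeI2002, §9.3.2 Prop. 9.20] -/
theorem exists_forall_norm_pullback_typeLow_sub_le [IsManifold 𝓘(ℂ, E₀) ω M₀] (k p : ℕ) :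
    letI : RiemannianBundle (fun x : M₀ ↦ TangentSpace 𝓘(ℝ, E₀) x) := ⟨g₀.toRiemannianMetric⟩
    ∀ (_hJ₀ : ∀ (x : M₀) (v w : TangentSpace 𝓘(ℝ, E₀) x),
        ⟪tangentJ E₀ x v, tangentJ E₀ x w⟫_ℝ = ⟪v, w⟫_ℝ)
      (ho₀ : IsSmoothForm (riemannianVolumeForm o₀))
      (b : ∀ x : M₀, OrthonormalBasis (Fin n) ℝ (TangentSpace 𝓘(ℝ, E₀) x)),
      (∀ x, (b x).toBasis.orientation = o₀ x) →
      ∃ δ₀ : ℝ, 0 < δ₀ ∧ ∀ {E₁ : Type u₁} [NormedAddCommGroup E₁] [NormedSpace ℂ E₁]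
        [FiniteDimensional ℂ E₁] [Fact (finrank ℝ E₁ = n)] [MeasurableSpace E₁] [BorelSpace E₁]
        {M₁ : Type u₃} [TopologicalSpace M₁] [ChartedSpace E₁ M₁] [T2Space M₁] [CompactSpace M₁]
        [IsManifold 𝓘(ℝ, E₁) ∞ M₁] [IsManifold 𝓘(ℂ, E₁) ω M₁]
        [RiemannianBundle (fun y : M₁ ↦ TangentSpace 𝓘(ℝ, E₁) y)]
        [IsContMDiffRiemannianBundle 𝓘(ℝ, E₁) ∞ E₁ (fun y : M₁ ↦ TangentSpace 𝓘(ℝ, E₁) y)]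
        (o₁ : (y : M₁) → Orientation ℝ (TangentSpace 𝓘(ℝ, E₁) y) (Fin n))
        (ho₁ : IsSmoothForm (riemannianVolumeForm o₁))
        (_hJ₁ : ∀ (y : M₁) (v w : TangentSpace 𝓘(ℝ, E₁) y),
          ⟪tangentJ E₁ y v, tangentJ E₁ y w⟫_ℝ = ⟪v, w⟫_ℝ)
        (Φ : Diffeomorph 𝓘(ℝ, E₀) 𝓘(ℝ, E₁) M₀ M₁ ∞)
        (_hΦ : ∀ x, Orientation.map (Fin n)
          (Φ.mfderivToContinuousLinearEquiv (by simp) x).toLinearEquiv (o₀ x) = o₁ (Φ x))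
        {δ : ℝ} (_hδ0 : 0 ≤ δ) (_hδ : δ ≤ δ₀)
        (_hT : ∀ x i j, |⟪mfderiv 𝓘(ℝ, E₀) 𝓘(ℝ, E₁) Φ x (b x i),
          mfderiv 𝓘(ℝ, E₀) 𝓘(ℝ, E₁) Φ x (b x j)⟫_ℝ - (if i = j then 1 else 0)| ≤ δ)
        {κ : ℝ} (_hκ0 : 0 ≤ κ)
        (_hJ : ∀ x, ‖(tangentJ E₁ (Φ x)).comp (mfderiv 𝓘(ℝ, E₀) 𝓘(ℝ, E₁) Φ x) -
          (mfderiv 𝓘(ℝ, E₀) 𝓘(ℝ, E₁) Φ x).comp (tangentJ E₀ x)‖ ≤ κ)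
        {u : MForm 𝓘(ℝ, E₁) M₁ ℂ k} (hu : IsSmoothForm u)
        (h₁ : IsSmoothForm ((∑ pq ∈ (antidiagonal k).filter (fun pq ↦ pq.1 < p),
          u.typeComponent pq.1 pq.2).pullback 𝓘(ℝ, E₀) Φ))
        (h₂ : IsSmoothForm (∑ pq ∈ (antidiagonal k).filter (fun pq ↦ pq.1 < p),
          (u.pullback 𝓘(ℝ, E₀) Φ).typeComponent pq.1 pq.2))
        (h₃ : IsSmoothForm (u.pullback 𝓘(ℝ, E₀) Φ)),
        haveI : Fact (IsSmoothForm (riemannianVolumeForm o₀)) := ⟨ho₀⟩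
        ‖CL2SmoothForms.mk o₀ _ h₁ - CL2SmoothForms.mk o₀ _ h₂‖ ≤
          (4 * ((k : ℝ) + 2) * ((k : ℝ) + 1) *
            Real.sqrt (4 * (n : ℝ) ^ (2 * k) * ((k : ℝ) * 2 ^ (k - 1) * 2 ^ k) ^ 2)) * κ *
            ‖CL2SmoothForms.mk o₀ _ h₃‖ := by
  letI i₀ : RiemannianBundle (fun x : M₀ ↦ TangentSpace 𝓘(ℝ, E₀) x) := ⟨g₀.toRiemannianMetric⟩
  haveI : IsContMDiffRiemannianBundle 𝓘(ℝ, E₀) ∞ E₀ (fun x : M₀ ↦ TangentSpace 𝓘(ℝ, E₀) x) :=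
    ⟨g₀.inner, g₀.contMDiff, fun _ _ _ ↦ rfl⟩
  intro hJ₀ ho₀ b hb
  haveI : Fact (IsSmoothForm (riemannianVolumeForm o₀)) := ⟨ho₀⟩
  classical
  -- the quantitative transport lemma at accuracy `1/12`, and `n δ ≤ 3/4`
  obtain ⟨δ₁, hδ₁, hR⟩ := exists_forall_norm_cl2Inner_transport_sub_le o₀ ho₀ b hb k
    (ε := 1 / 12) (by norm_num)
  refine ⟨min δ₁ (1 / (4 * (n : ℝ) + 4)), lt_min hδ₁ (by positivity), ?_⟩
  intro E₁ _ _ _ _ _ _ M₁ _ _ _ _ _ _ _ _ o₁ ho₁ hJ₁ Φ hΦ δ hδ0 hδ hT κ hκ0 hJ u hu h₁ h₂ h₃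
  haveI : IsContinuousRiemannianBundle E₁ (fun y : M₁ ↦ TangentSpace 𝓘(ℝ, E₁) y) :=
    isContinuousRiemannianBundle_of_isContMDiffRiemannianBundle 𝓘(ℝ, E₁) ∞
  haveI : Fact (IsSmoothForm (riemannianVolumeForm o₁)) := ⟨ho₁⟩
  have hδ₁' : δ ≤ δ₁ := hδ.trans (min_le_left _ _)
  have hφn : (n : ℝ) * δ ≤ 3 / 4 := by
    have h1 : δ ≤ 1 / (4 * (n : ℝ) + 4) := hδ.trans (min_le_right _ _)
    have hn : (0 : ℝ) ≤ n := n.cast_nonneg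
    have h2 : (n : ℝ) * δ ≤ n * (1 / (4 * (n : ℝ) + 4)) := mul_le_mul_of_nonneg_left h1 hn
    have h3 : (n : ℝ) * (1 / (4 * (n : ℝ) + 4)) ≤ 1 / 4 := by
      rw [mul_one_div, div_le_iff₀ (by positivity)]
      linarith
    linarith
  /- ### Operator bounds for `DΦ` -/
  have hTnorm : ∀ x, ‖(mfderiv 𝓘(ℝ, E₀) 𝓘(ℝ, E₁) Φ x)‖ ≤ 2 := by
    intro x
    refine ContinuousLinearMap.opNorm_le_bound _ zero_le_two fun v ↦ ?_
    have hh1 := abs_norm_sq_map_sub_le_of_gram (mfderiv 𝓘(ℝ, E₀) 𝓘(ℝ, E₁) Φ x) (b x) hδ0 (hT x) v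
    have hh2 : ‖mfderiv 𝓘(ℝ, E₀) 𝓘(ℝ, E₁) Φ x v‖ ^ 2 ≤ (2 * ‖v‖) ^ 2 := by
      have := (abs_le.1 hh1).2
      nlinarith [hφn, sq_nonneg ‖v‖, mul_nonneg hδ0 (sq_nonneg ‖v‖)]
    exact (pow_le_pow_iff_left₀ (norm_nonneg _) (by positivity) two_ne_zero).1 hh2
  have hSnorm : ∀ x, ‖((Φ.mfderivToContinuousLinearEquiv (by simp) x).symm :
      TangentSpace 𝓘(ℝ, E₁) (Φ x) →L[ℝ] TangentSpace 𝓘(ℝ, E₀) x)‖ ≤ 2 := fun x ↦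
    norm_symm_le_two_of_gram (Φ.mfderivToContinuousLinearEquiv (by simp) x) (b x) hδ0 hφn (hT x)
  have hA : ∀ x (θ : ℝ), ‖(tangentRotate E₁ (Φ x) θ).comp
      (mfderiv 𝓘(ℝ, E₀) 𝓘(ℝ, E₁) Φ x)‖ ≤ 2 := fun x θ ↦
    (ContinuousLinearMap.opNorm_comp_le _ _).trans (by
      have := norm_tangentRotate_le_one (hJ₁ (Φ x)) θ
      have := hTnorm x
      nlinarith [norm_nonneg (tangentRotate E₁ (Φ x) θ),
        norm_nonneg (mfderiv 𝓘(ℝ, E₀) 𝓘(ℝ, E₁) Φ x)])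
  have hB : ∀ x (θ : ℝ), ‖(mfderiv 𝓘(ℝ, E₀) 𝓘(ℝ, E₁) Φ x).comp (tangentRotate E₀ x θ)‖ ≤ 2 :=
    fun x θ ↦ (ContinuousLinearMap.opNorm_comp_le _ _).trans (by
      have := norm_tangentRotate_le_one (hJ₀ x) θ
      have := hTnorm x
      nlinarith [norm_nonneg (tangentRotate E₀ x θ),
        norm_nonneg (mfderiv 𝓘(ℝ, E₀) 𝓘(ℝ, E₁) Φ x)])
  have hAB : ∀ x (θ : ℝ), ‖(tangentRotate E₁ (Φ x) θ).comp (mfderiv 𝓘(ℝ, E₀) 𝓘(ℝ, E₁) Φ x) -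
      (mfderiv 𝓘(ℝ, E₀) 𝓘(ℝ, E₁) Φ x).comp (tangentRotate E₀ x θ)‖ ≤ κ :=
    fun x θ ↦ (norm_tangentRotate_comp_sub_comp_tangentRotate_le _ θ).trans (hJ x)
  /- ### Notation -/
  set Cst : ℝ := 4 * (n : ℝ) ^ (2 * k) * ((k : ℝ) * 2 ^ (k - 1) * 2 ^ k) ^ 2 with hCst
  have hCst0 : 0 ≤ Cst := by positivity
  set A := antidiagonal k with hAdef
  set S₁ := A.filter (fun pq ↦ pq.1 < p) with hS₁
  have hS₁A : S₁ ⊆ A := Finset.filter_subset _ _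
  have hinj : ∀ a c : CL2SmoothForms o₀ k,
      CL2SmoothForms.toForm o₀ a = CL2SmoothForms.toForm o₀ c → a = c := fun a c hac ↦ Subtype.ext hac
  -- the partial projector on `M₀` as a linear map of forms
  let TL : MForm 𝓘(ℝ, E₀) M₀ ℂ k →ₗ[ℂ] MForm 𝓘(ℝ, E₀) M₀ ℂ k :=
    { toFun := fun x ↦ ∑ pq ∈ S₁, x.typeComponent pq.1 pq.2
      map_add' := fun x y ↦ by simp only [MForm.typeComponent_add, Finset.sum_add_distrib]
      map_smul' := fun c x ↦ by
        simp only [MForm.typeComponent_smul, Finset.smul_sum, RingHom.id_apply] }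
  have hTL : ∀ x, TL x = ∑ pq ∈ S₁, x.typeComponent pq.1 pq.2 := fun _ ↦ rfl
  have hTLs : ∀ {x : MForm 𝓘(ℝ, E₀) M₀ ℂ k}, IsSmoothForm x → IsSmoothForm (TL x) := fun hx ↦
    (smoothForms 𝓘(ℝ, E₀) M₀ ℂ k).sum_mem fun pq _ ↦ hx.typeComponent pq.1 pq.2
  -- `TL` on a form of pure type `pq ∈ A`
  have hTLpure : ∀ pq ∈ A, ∀ {x : MForm 𝓘(ℝ, E₀) M₀ ℂ k}, IsOfType pq.1 pq.2 x →
      TL x = if pq ∈ S₁ then x else 0 := by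
    intro pq _ x hx
    rw [hTL]
    have hterm : ∀ pq' ∈ S₁, x.typeComponent pq'.1 pq'.2 = if pq = pq' then x else 0 := by
      intro pq' _
      split_ifs with hpp
      · subst hpp; exact hx.typeComponent_eq_self
      · refine IsOfType.typeComponent_of_ne_holds hx ?_
        by_contra hcon
        push Not at hcon
        exact hpp (Prod.ext hcon.1 hcon.2)
    rw [Finset.sum_congr rfl hterm, Finset.sum_ite_eq]
  /- ### The pieces `w_{pq} = Φ^* u^{pq}` and their type defects `D_{pq}` -/
  set w : ℕ × ℕ → MForm 𝓘(ℝ, E₀) M₀ ℂ k := fun pq ↦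
    (u.typeComponent pq.1 pq.2).pullback 𝓘(ℝ, E₀) Φ with hwdef
  have hus : ∀ pq : ℕ × ℕ, IsSmoothForm (u.typeComponent pq.1 pq.2) := fun pq ↦
    hu.typeComponent pq.1 pq.2
  have hws : ∀ pq : ℕ × ℕ, IsSmoothForm (w pq) := fun pq ↦
    isSmoothForm_pullback Φ.contMDiff (hus pq)
  set D : ℕ × ℕ → MForm 𝓘(ℝ, E₀) M₀ ℂ k := fun pq ↦ w pq - (w pq).typeComponent pq.1 pq.2 with hDdef
  have hDs : ∀ pq : ℕ × ℕ, IsSmoothForm (D pq) := fun pq ↦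
    (smoothForms 𝓘(ℝ, E₀) M₀ ℂ k).sub_mem (hws pq) ((hws pq).typeComponent pq.1 pq.2)
  /- ### The algebraic identity `Φ^*(Π₁ u) - Π₀(Φ^*u) = ∑_{S₁} D - ∑_A TL D` -/
  have hident : (∑ pq ∈ S₁, u.typeComponent pq.1 pq.2).pullback 𝓘(ℝ, E₀) Φ -
      ∑ pq ∈ S₁, (u.pullback 𝓘(ℝ, E₀) Φ).typeComponent pq.1 pq.2 =
        ∑ pq ∈ S₁, D pq - ∑ pq ∈ A, TL (D pq) := by
    -- `Φ^*(Π₁ u) = ∑_{S₁} w`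
    have e1 : (∑ pq ∈ S₁, u.typeComponent pq.1 pq.2).pullback 𝓘(ℝ, E₀) Φ = ∑ pq ∈ S₁, w pq := by
      rw [← MForm.cpullbackₗ_apply, map_sum]; rfl
    -- `Φ^*u = ∑_A w`
    have e2 : u.pullback 𝓘(ℝ, E₀) Φ = ∑ pq ∈ A, w pq := by
      conv_lhs => rw [← sum_antidiagonal_typeComponent_holds u]
      rw [← MForm.cpullbackₗ_apply, map_sum]; rfl
    -- `Π₀(Φ^*u) = ∑_A TL w`
    have e3 : ∑ pq ∈ S₁, (u.pullback 𝓘(ℝ, E₀) Φ).typeComponent pq.1 pq.2 = ∑ pq ∈ A, TL (w pq) := by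
      rw [← hTL, e2, map_sum]
    -- `TL w = TL D + [pq ∈ S₁] (w^{pq})`
    have e4 : ∀ pq ∈ A, TL (w pq) = TL (D pq) + if pq ∈ S₁ then (w pq).typeComponent pq.1 pq.2 else 0 := by
      intro pq hpq
      have hpqk : pq.1 + pq.2 = k := mem_antidiagonal.1 hpq
      rw [← hTLpure pq hpq (isOfType_typeComponent_holds hpqk (w pq)), ← map_add]
      congr 1
      simp only [D, sub_add_cancel]
    rw [e1, e3, Finset.sum_congr rfl e4, Finset.sum_add_distrib, Finset.sum_ite_mem,
      Finset.inter_eq_right.2 hS₁A]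
    have e5 : ∑ pq ∈ S₁, D pq = ∑ pq ∈ S₁, w pq - ∑ pq ∈ S₁, (w pq).typeComponent pq.1 pq.2 := by
      rw [← Finset.sum_sub_distrib]
    rw [e5]
    abel
  /- ### Norm bounds -/
  set N : ℝ := ‖CL2SmoothForms.mk o₀ _ h₃‖ with hN
  -- pull-back algebra along `Φ` and `Φ⁻¹`
  have hpb_symm : ∀ γ : MForm 𝓘(ℝ, E₁) M₁ ℂ k,
      (γ.pullback 𝓘(ℝ, E₀) Φ).pullback 𝓘(ℝ, E₁) Φ.symm = γ := by
    intro γ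
    rw [← MForm.pullback_comp (Φ.mdifferentiable (by simp)) (Φ.symm.mdifferentiable (by simp))]
    have : ((Φ : M₀ → M₁) ∘ (Φ.symm : M₁ → M₀)) = id := funext fun y ↦ Φ.apply_symm_apply y
    rw [this, MForm.pullback_id]
  -- `‖Φ^*a‖₀ ≤ 2 ‖a‖₁` and `‖a‖₁ ≤ 2 ‖Φ^*a‖₀` for smooth `a` on `M₁`
  have hnorm : ∀ {a : MForm 𝓘(ℝ, E₁) M₁ ℂ k} (ha : IsSmoothForm a),
      ‖CL2SmoothForms.mk o₀ (a.pullback 𝓘(ℝ, E₀) Φ) (isSmoothForm_pullback Φ.contMDiff ha)‖ ≤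
        2 * ‖CL2SmoothForms.mk o₁ a ha‖ ∧
      ‖CL2SmoothForms.mk o₁ a ha‖ ≤
        2 * ‖CL2SmoothForms.mk o₀ (a.pullback 𝓘(ℝ, E₀) Φ) (isSmoothForm_pullback Φ.contMDiff ha)‖ := by
    intro a ha
    have has := isSmoothForm_pullback Φ.contMDiff ha
    have key := hR o₁ ho₁ Φ hΦ hδ0 hδ₁' hT has has
    rw [hpb_symm] at key
    have e0 : (MForm.cl2Inner o₀ (a.pullback 𝓘(ℝ, E₀) Φ) (a.pullback 𝓘(ℝ, E₀) Φ)).re =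
        ‖CL2SmoothForms.mk o₀ (a.pullback 𝓘(ℝ, E₀) Φ) has‖ ^ 2 := (CL2SmoothForms.norm_mk_sq o₀ has).symm
    have e1 : (MForm.cl2Inner o₁ a a).re = ‖CL2SmoothForms.mk o₁ a ha‖ ^ 2 :=
      (CL2SmoothForms.norm_mk_sq o₁ ha).symm
    have hre := (Complex.abs_re_le_norm _).trans key
    rw [Complex.sub_re, e0, e1] at hre
    set X := ‖CL2SmoothForms.mk o₀ (a.pullback 𝓘(ℝ, E₀) Φ) has‖
    set Y := ‖CL2SmoothForms.mk o₁ a ha‖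
    have hX : 0 ≤ X := norm_nonneg _
    have hY : 0 ≤ Y := norm_nonneg _
    obtain ⟨hl, hr⟩ := abs_le.1 hre
    constructor
    · have : X ^ 2 ≤ (2 * Y) ^ 2 := by nlinarith
      exact (pow_le_pow_iff_left₀ hX (by positivity) two_ne_zero).1 this
    · have : Y ^ 2 ≤ (2 * X) ^ 2 := by nlinarith
      exact (pow_le_pow_iff_left₀ hY (by positivity) two_ne_zero).1 this
  -- `‖w_{pq}‖ ≤ 4 N`
  have hw_le : ∀ pq : ℕ × ℕ, ‖CL2SmoothForms.mk o₀ (w pq) (hws pq)‖ ≤ 4 * N := by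
    intro pq
    have ha := (hnorm (hus pq)).1
    have hb' := norm_mk_typeComponent_le o₁ hJ₁ pq.1 pq.2 hu
    have hc := (hnorm hu).2
    have e : CL2SmoothForms.mk o₀ (w pq) (hws pq) =
        CL2SmoothForms.mk o₀ ((u.typeComponent pq.1 pq.2).pullback 𝓘(ℝ, E₀) Φ)
          (isSmoothForm_pullback Φ.contMDiff (hus pq)) := rfl
    have e' : CL2SmoothForms.mk o₀ (u.pullback 𝓘(ℝ, E₀) Φ) (isSmoothForm_pullback Φ.contMDiff hu) =
        CL2SmoothForms.mk o₀ _ h₃ := rfl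
    rw [e]
    rw [e'] at hc
    linarith
  -- `‖D_{pq}‖ ≤ √Cst κ ‖w_{pq}‖`
  have hD_le : ∀ pq ∈ A, ‖CL2SmoothForms.mk o₀ (D pq) (hDs pq)‖ ≤
      Real.sqrt Cst * κ * ‖CL2SmoothForms.mk o₀ (w pq) (hws pq)‖ := by
    intro pq hpq
    have hpqk : pq.1 + pq.2 = k := mem_antidiagonal.1 hpq
    have hdef := re_cl2Inner_typeDefect_le (k := k) o₀ ho₀ Φ (hus pq)
      (isOfType_typeComponent_holds hpqk u) (Λ := 2) (σ := 2) (κ := κ) zero_le_two hκ0 hSnorm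
      (fun x j ↦ hA x _) (fun x j ↦ hB x _) (fun x j ↦ hAB x _)
    have hsq : ‖CL2SmoothForms.mk o₀ (D pq) (hDs pq)‖ ^ 2 ≤
        (Real.sqrt Cst * κ * ‖CL2SmoothForms.mk o₀ (w pq) (hws pq)‖) ^ 2 := by
      rw [CL2SmoothForms.norm_mk_sq, mul_pow, mul_pow, Real.sq_sqrt hCst0, CL2SmoothForms.norm_mk_sq,
        hCst]
      simp only [hDdef, hwdef]
      exact hdef
    have h0 : 0 ≤ Real.sqrt Cst * κ * ‖CL2SmoothForms.mk o₀ (w pq) (hws pq)‖ :=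
      mul_nonneg (mul_nonneg (Real.sqrt_nonneg _) hκ0) (norm_nonneg _)
    exact (pow_le_pow_iff_left₀ (norm_nonneg _) h0 two_ne_zero).1 hsq
  have hD_le' : ∀ pq ∈ A, ‖CL2SmoothForms.mk o₀ (D pq) (hDs pq)‖ ≤ Real.sqrt Cst * κ * (4 * N) := by
    intro pq hpq
    exact (hD_le pq hpq).trans (mul_le_mul_of_nonneg_left (hw_le pq)
      (mul_nonneg (Real.sqrt_nonneg _) hκ0))
  -- `‖TL x‖ ≤ (k + 1) ‖x‖`
  have hTL_le : ∀ {x : MForm 𝓘(ℝ, E₀) M₀ ℂ k} (hx : IsSmoothForm x),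
      ‖CL2SmoothForms.mk o₀ (TL x) (hTLs hx)‖ ≤ (k + 1) * ‖CL2SmoothForms.mk o₀ x hx‖ :=
    fun hx ↦ norm_mk_sum_typeComponent_le o₀ hJ₀ S₁ hS₁A hx _
  /- ### Conclusion -/
  have hmk : CL2SmoothForms.mk o₀ _ h₁ - CL2SmoothForms.mk o₀ _ h₂ =
      ∑ pq ∈ S₁, CL2SmoothForms.mk o₀ (D pq) (hDs pq) -
        ∑ pq ∈ A, CL2SmoothForms.mk o₀ (TL (D pq)) (hTLs (hDs pq)) := by
    apply hinj
    rw [CL2SmoothForms.toForm_sub, CL2SmoothForms.toForm_sub, CL2SmoothForms.toForm_sum,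
      CL2SmoothForms.toForm_sum]
    simp only [CL2SmoothForms.toForm_mk]
    exact hident
  rw [hmk]
  calc ‖∑ pq ∈ S₁, CL2SmoothForms.mk o₀ (D pq) (hDs pq) -
        ∑ pq ∈ A, CL2SmoothForms.mk o₀ (TL (D pq)) (hTLs (hDs pq))‖
      ≤ ∑ pq ∈ S₁, ‖CL2SmoothForms.mk o₀ (D pq) (hDs pq)‖ +
          ∑ pq ∈ A, ‖CL2SmoothForms.mk o₀ (TL (D pq)) (hTLs (hDs pq))‖ :=
        (norm_sub_le _ _).trans (add_le_add (norm_sum_le _ _) (norm_sum_le _ _))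
    _ ≤ ∑ pq ∈ A, ‖CL2SmoothForms.mk o₀ (D pq) (hDs pq)‖ +
          ∑ pq ∈ A, (k + 1) * ‖CL2SmoothForms.mk o₀ (D pq) (hDs pq)‖ :=
        add_le_add (Finset.sum_le_sum_of_subset_of_nonneg hS₁A fun _ _ _ ↦ norm_nonneg _)
          (Finset.sum_le_sum fun pq _ ↦ hTL_le (hDs pq))
    _ = ((k : ℝ) + 2) * ∑ pq ∈ A, ‖CL2SmoothForms.mk o₀ (D pq) (hDs pq)‖ := by
        rw [← Finset.mul_sum]; ring
    _ ≤ ((k : ℝ) + 2) * ∑ pq ∈ A, Real.sqrt Cst * κ * (4 * N) :=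
        mul_le_mul_of_nonneg_left (Finset.sum_le_sum hD_le') (by positivity)
    _ = ((k : ℝ) + 2) * ((k + 1 : ℕ) * (Real.sqrt Cst * κ * (4 * N))) := by
        rw [Finset.sum_const, hAdef, Finset.Nat.card_antidiagonal, nsmul_eq_mul]
    _ = (4 * ((k : ℝ) + 2) * ((k : ℝ) + 1) * Real.sqrt Cst) * κ * N := by push_cast; ring

end Literature.AlgebraicGeometry.HodgeTheory
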